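import Literature.Computability.QuantumComplexity.ReversibleCliffordT
import HarnessLib

/-!
# The fan-out stage: copying input bits into ancilla wires with CNOTs

Topic `Literature/Computability/QuantumComplexity`; a step in the discharge of
`ajl_jonesApproxProblem_mem_PromiseBQP` (the classical preamble of the AJL circuit: every
Hadamard-test copy receives its own copy of the braid-word table and of the pattern of `|α⟩`).
A list of (source, target) pairs is compiled to CNOTs (`fanoutOps`); if the targets are pairwise
distinct, no target is a source, and the targets are off in the input, the classical semantics
writes the source bits onto the targets and leaves every other wire alone (`revEval_fanoutOps_target`,
`revEval_fanoutOps_of_not_target`).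

## References

* M. A. Nielsen, I. L. Chuang, *Quantum Computation and Quantum Information*, CUP 2010, §3.2.5
  (FANOUT with CNOT and an ancilla) [NielsenChuang2010].
-/

namespace Literature.Computability.QuantumComplexity

open _root_.Matrix Cryptography

variable {W : ℕ}

/-- The CNOTs copying each source onto its target. [cite: NielsenChuang2010, §3.2.5] -/
def fanoutOps (pairs : List (Fin W × Fin W)) (h : ∀ p ∈ pairs, p.1 ≠ p.2) : List (RevOp W) :=
  pairs.attach.map fun p => RevOp.cnot p.1.1 p.1.2 (h p.1 p.2)

/-- `fanoutOps` of a cons. [folklore] -/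
theorem fanoutOps_cons (p : Fin W × Fin W) (pairs : List (Fin W × Fin W)) (h : ∀ p' ∈ p :: pairs, p'.1 ≠ p'.2) :
    fanoutOps (p :: pairs) h = RevOp.cnot p.1 p.2 (h p (List.mem_cons_self ..)) :: fanoutOps pairs (fun p' hp' => h p' (List.mem_cons_of_mem _ hp')) := by
  simp [fanoutOps, List.attach_cons, List.map_map, Function.comp_def]

/-- **Semantics of the fan-out off the targets**: wires that are not targets are unchanged. [folklore] -/
theorem revEval_fanoutOps_of_not_target : ∀ (pairs : List (Fin W × Fin W)) (h : ∀ p ∈ pairs, p.1 ≠ p.2) (z : QReg W) (w : Fin W),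
    (∀ p ∈ pairs, p.2 ≠ w) → revEval (fanoutOps pairs h) z w = z w
  | [], _, z, w, _ => by simp [fanoutOps, revEval]
  | p :: pairs, h, z, w, hw => by
    rw [fanoutOps_cons, revEval, revEval_fanoutOps_of_not_target pairs _ _ w (fun p' hp' => hw p' (List.mem_cons_of_mem _ hp')), RevOp.eval,
      Function.update_of_ne (hw p (List.mem_cons_self ..)).symm]

/-- **Semantics of the fan-out on the targets**: with pairwise distinct targets, no target a source,
and all targets off in the input, target `p.2` receives the source bit `z p.1`. [cite: NielsenChuang2010, §3.2.5] -/
theorem revEval_fanoutOps_target : ∀ (pairs : List (Fin W × Fin W)) (h : ∀ p ∈ pairs, p.1 ≠ p.2), (pairs.map Prod.snd).Nodup →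
    (∀ p ∈ pairs, ∀ p' ∈ pairs, p.1 ≠ p'.2) → ∀ z : QReg W, (∀ p ∈ pairs, z p.2 = false) → ∀ p ∈ pairs, revEval (fanoutOps pairs h) z p.2 = z p.1
  | [], _, _, _, _, _, p, hp => by simp at hp
  | p₀ :: pairs, h, hnd, hsrc, z, hz, p, hp => by
    rw [List.map_cons, List.nodup_cons] at hnd
    rw [fanoutOps_cons, revEval]
    have hz₀ : RevOp.eval (RevOp.cnot p₀.1 p₀.2 (h p₀ (List.mem_cons_self ..))) z = Function.update z p₀.2 (z p₀.1) := by
      rw [RevOp.eval, hz p₀ (List.mem_cons_self ..), Bool.false_xor]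
    rw [hz₀]
    rcases List.mem_cons.1 hp with rfl | hp'
    · -- the head target is not touched again, and holds the source bit
      rw [revEval_fanoutOps_of_not_target pairs _ _ p.2 (fun p' hp' h' => hnd.1 (by rw [← h']; exact List.mem_map.2 ⟨p', hp', rfl⟩)), Function.update_self]
    · rw [revEval_fanoutOps_target pairs _ hnd.2 (fun q hq q' hq' => hsrc q (List.mem_cons_of_mem _ hq) q' (List.mem_cons_of_mem _ hq')) _
        (fun q hq => by
          rw [Function.update_of_ne (fun h' => hnd.1 (by rw [← h']; exact List.mem_map.2 ⟨q, hq, rfl⟩))]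
          exact hz q (List.mem_cons_of_mem _ hq)) p hp',
        Function.update_of_ne (hsrc p (List.mem_cons_of_mem _ hp') p₀ (List.mem_cons_self ..))]

/-- The fan-out circuit maps basis states to basis states. [cite: NielsenChuang2010, §3.2.5] -/
theorem fanout_mulVec_basisState (pairs : List (Fin W × Fin W)) (h : ∀ p ∈ pairs, p.1 ≠ p.2) (z : QReg W) :
    (⟨revCompile (fanoutOps pairs h)⟩ : QCircuit cliffordT W).toMatrix 0 *ᵥ basisState z = basisState (revEval (fanoutOps pairs h) z) :=
  revCompile_mulVec_basisState 0 _ z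

end Literature.Computability.QuantumComplexity
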